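import Summits.Ventures.HodgeRepro2.T6A2WeilAlg

/-!
# T6A2WeilPush — the push-forward of an algebraic class is algebraic (discharging `PushAlg`)

Cell pub-hodge-repro2, Tier 6 (README §10), seat t6-p2 (A2 host side). `push W g` (the adjoint Gysin map of
`T6A2WeilRing`) maps `algSub W P` into `algSub W Q`: the degree-`p` component of an algebraic class is sent to
the degree-`p + dim Y − dim X` component by a linear map `T` INDUCED (in the host's sense, `IsInducedBy`) by the
transposed graph class `β^* u` of `g` (`exists_isInducedBy_pullback` gives `u` inducing `g^*`), which is
algebraic by `pullback_ratAlgebraicClasses_le`; the host's `map_ratAlgebraicClasses_of_isInducedBy` then gives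
`T a ∈ ratAlgebraicClasses`. The transfer from `g^*` to its adjoint uses the braiding-invariance of the
top-degree trace (`trace_pullback_braiding`: Künneth surjectivity `bijective_kunnethMap` + `trace_externalCup`
+ the vanishing above the dimension) and the even-degree commutativity of the cup product on `X ⊗ Y`.
Inputs beyond `W`: the smoothness of the products `X ⊗ Y`, `Y ⊗ X` — the host's NAMED fact
`IsSmoothProjective.tensor` (Varieties.lean l. 122), taken as binders. No `sorry`; standard axioms.
§8(d): uses an L-value-free non-vanishing device: NO.
-/

noncomputable section

namespace Summit.Ventures.HodgeRepro2.T6.WeilInst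

open HostAPI.Carriers.AlgebraicGeometry.Motives CategoryTheory Opposite MonoidalCategory
  CartesianMonoidalCategory
open Summit.Ventures.HodgeRepro2.T6.A2Gysin
open scoped DirectSum TensorProduct

universe u

variable {k : Type u} [Field k] (W : WeilCohomology k ℚ)

section cast

variable {X : SchemeOver k}

/-- transport along an equality of degrees -/
def castDeg {m m' : ℕ} (h : m = m') : W.obj X m ≃ₗ[ℚ] W.obj X m' := by
  subst h; exact LinearEquiv.refl ℚ _

/-- the trivial transport is the identity -/
@[simp] theorem castDeg_rfl {m : ℕ} (a : W.obj X m) : castDeg W (rfl : m = m) a = a := rfl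

/-- the transport is heterogeneously the identity -/
theorem castDeg_heq {m m' : ℕ} (h : m = m') (a : W.obj X m) : HEq (castDeg W h a) a := by
  subst h; rfl

/-- the trace is invariant under the transport of the degree -/
theorem trace_castDeg {n n' : ℕ} (h : n = n') (a : W.obj X (2 * n)) :
    W.trace X n' (castDeg W (by rw [h]) a) = W.trace X n a := by
  subst h; rfl

/-- the transport of a cup product is the cup product with the composed degree equation -/
theorem castDeg_cup {i j m m' : ℕ} (h : i + j = m) (h' : m = m') (a : W.obj X i) (b : W.obj X j) :
    castDeg W h' (W.cup h a b) = W.cup (h.trans h') a b := by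
  subst h'; rfl

/-- the pull-back commutes with the transport -/
theorem pullback_castDeg {Y : SchemeOver k} (f : X ⟶ Y) {m m' : ℕ} (h : m = m') (a : W.obj Y m) :
    W.pullback f m' (castDeg W h a) = castDeg W h (W.pullback f m a) := by
  subst h; rfl

end cast

section braiding

variable (P Q : SPVar k)

/-- the even-degree cup product commutes on a smooth projective variety (any even degrees) -/
theorem cup_comm_even' {X : SchemeOver k} {n : ℕ} (hX : IsSmoothProjective n X) {i j m : ℕ}
    (h : 2 * i + 2 * j = m) (h' : 2 * j + 2 * i = m) (a : W.obj X (2 * i)) (b : W.obj X (2 * j)) :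
    W.cup h a b = W.cup h' b a := by
  rw [W.cup_comm hX h h' a b]
  have : ((2 * i : ℕ) * (2 * j : ℕ) : ℤ).negOnePow = 1 := by
    apply Int.negOnePow_even
    exact ⟨(i * (2 * j) : ℕ), by push_cast; ring⟩
  rw [this]
  simp

/-- composite pull-backs -/
theorem pullback_pullback {X Y Z : SchemeOver k} (f : X ⟶ Y) (g : Y ⟶ Z) (i : ℕ) (a : W.obj Z i) :
    W.pullback f i (W.pullback g i a) = W.pullback (f ≫ g) i a := by
  rw [W.pullback_comp]; rfl

/-- the external cup product, unfolded -/
theorem externalCup_apply {X Y : SchemeOver k} {i j m : ℕ} (h : i + j = m) (a : W.obj X i) (b : W.obj Y j) :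
    W.externalCup X Y h a b = W.cup h (W.pullback (fst X Y) i a) (W.pullback (snd X Y) j b) := rfl

/-- THE BRAIDING-INVARIANCE OF THE TOP-DEGREE TRACE: `∫_{X × Y} β^* w = ∫_{Y × X} w` (Künneth +
`trace_externalCup` + the vanishing above the dimension). -/
theorem trace_pullback_braiding (hPQ : IsSmoothProjective (P.n + Q.n) (P.X ⊗ Q.X))
    (hQP : IsSmoothProjective (Q.n + P.n) (Q.X ⊗ P.X)) (n : ℕ)
    (hn : n = Q.n + P.n) (w : W.obj (Q.X ⊗ P.X) (2 * n)) :
    W.trace (P.X ⊗ Q.X) n (W.pullback (β_ P.X Q.X).hom (2 * n) w) = W.trace (Q.X ⊗ P.X) n w := by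
  classical
  subst hn
  obtain ⟨t, rfl⟩ := (W.bijective_kunnethMap Q.smooth P.smooth (2 * (Q.n + P.n))).2 w
  induction t using DirectSum.induction_on with
  | zero => simp
  | add t₁ t₂ h₁ h₂ => simp only [map_add, h₁, h₂]
  | of ij t =>
    obtain ⟨⟨i, j⟩, hij⟩ := ij
    have hij' : i + j = 2 * (Q.n + P.n) := Finset.HasAntidiagonal.mem_antidiagonal.mp hij
    simp only [PreWeilCohomology.kunnethMap]
    rw [← DirectSum.lof_eq_of ℚ, DirectSum.toModule_lof]
    induction t using TensorProduct.induction_on with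
    | zero => simp
    | add t₁ t₂ h₁ h₂ => simp only [map_add, h₁, h₂]
    | tmul a b =>
      rw [TensorProduct.lift.tmul]
      change W.trace (P.X ⊗ Q.X) (Q.n + P.n) (W.pullback (β_ P.X Q.X).hom _ (W.externalCup Q.X P.X hij' a b)) =
        W.trace (Q.X ⊗ P.X) (Q.n + P.n) (W.externalCup Q.X P.X hij' a b)
      rcases Nat.lt_trichotomy i (2 * Q.n) with hi | hi | hi
      · -- `j > 2 dim P`: `b = 0`
        haveI := W.subsingleton_obj P.smooth (i := j) (by omega)
        rw [Subsingleton.elim b 0]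
        simp
      · subst hi
        have hj : j = 2 * P.n := by omega
        subst hj
        rw [externalCup_apply, W.map_cup hPQ hQP, pullback_pullback, pullback_pullback,
          braiding_hom_fst, braiding_hom_snd,
          cup_comm_even' W hPQ hij' (by omega : 2 * P.n + 2 * Q.n = 2 * (Q.n + P.n)),
          ← trace_castDeg W (by omega : Q.n + P.n = P.n + Q.n), castDeg_cup, ← externalCup_apply,
          ← externalCup_apply, W.trace_externalCup P.smooth Q.smooth,
          W.trace_externalCup Q.smooth P.smooth, mul_comm]
      · -- `i > 2 dim Q`: `a = 0`
        haveI := W.subsingleton_obj Q.smooth (i := i) hi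
        rw [Subsingleton.elim a 0]
        simp

end braiding

section cupCast

variable {X : SchemeOver k}

/-- the cup product with a transported left factor -/
theorem cup_castDeg_left {i i' j m : ℕ} (h : i = i') (hc : i + j = m) (a : W.obj X i) (b : W.obj X j) :
    W.cup (by omega : i' + j = m) (castDeg W h a) b = W.cup hc a b := by
  subst h; rfl

end cupCast

section triple

variable (P : SPVar k)

/-- the trace as the integral of the even ring of `⟨X, n, hX⟩` -/
theorem trace_eq_integral (X : SchemeOver k) (n : ℕ) (hX : IsSmoothProjective n X) (z : W.obj X (2 * n)) :
    W.trace X n z = integral W ⟨X, n, hX⟩ (ofDeg W ⟨X, n, hX⟩ n z) :=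
  (integral_ofDeg_top W ⟨X, n, hX⟩ z).symm

/-- a triple cup product in the even ring -/
theorem ofDeg_cup_cup {i j l m : ℕ} (h₁ : i + j + l = m) (h : 2 * i + 2 * j + 2 * l = 2 * m)
    (a : Ev W P.X i) (b : Ev W P.X j) (c : Ev W P.X l) :
    ofDeg W P m (W.cup h (W.cup rfl a b) c) = ofDeg W P i a * ofDeg W P j b * ofDeg W P l c := by
  subst h₁
  rw [ofDeg_mul_ofDeg, ofDeg_mul_ofDeg]
  congr 1
  rw [← cup_castDeg_left W (by omega : 2 * i + 2 * j = 2 * (i + j)) (by omega : 2 * i + 2 * j + 2 * l = 2 * (i + j + l)),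
    castDeg_cup]

end triple

section pushAlg

variable {P Q : SPVar k} (g : P.X ⟶ Q.X)

/-- the degree-`q` component of the push-forward of a degree-`p` class -/
def pushDeg (p q : ℕ) : Ev W P.X p →ₗ[ℚ] Ev W Q.X q :=
  (DirectSum.component ℚ ℕ (Ev W Q.X) q) ∘ₗ (push W g) ∘ₗ (ofDeg W P p)

/-- `pushDeg`, unfolded -/
theorem pushDeg_apply (p q : ℕ) (a : Ev W P.X p) : pushDeg W g p q a = (push W g (ofDeg W P p a)) q := rfl

/-- the pairing of `g_*(ofDeg p a)` with a homogeneous class of `Y` -/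
theorem pairing_push_ofDeg_ofDeg (p j : ℕ) (a : Ev W P.X p) (b : Ev W Q.X j) :
    pairing W Q (push W g (ofDeg W P p a)) (ofDeg W Q j b) =
      if h : p + j = P.n then
        W.trace P.X P.n (W.cup (by omega : 2 * p + 2 * j = 2 * P.n) a (W.pullback g (2 * j) b)) else 0 := by
  rw [pairing_push, pull_ofDeg, pairing_apply, integral_ofDeg_mul_ofDeg]

/-- the components of `g_*(ofDeg p a)` vanish off the degree `p + dim Y − dim X` -/
theorem push_ofDeg_apply_eq_zero {p q' : ℕ} (a : Ev W P.X p) (hq' : q' ≤ Q.n)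
    (h : p + (Q.n - q') ≠ P.n) : (push W g (ofDeg W P p a)) q' = 0 := by
  have hperf := W.isPerfPair_cupPairing Q.smooth (2 * q') (2 * (Q.n - q')) (by omega)
  refine hperf.bijective_left.injective ?_
  rw [map_zero]
  ext b
  have := pairing_ofDeg_right W Q (push W g (ofDeg W P p a)) (by omega : q' + (Q.n - q') = Q.n) b
  rw [pairing_push_ofDeg_ofDeg, dif_neg h] at this
  simpa [PreWeilCohomology.cupPairing] using this.symm

/-- the components of a homogeneous element off its degree vanish -/
theorem ofDeg_apply_of_ne (R : SPVar k) {i j : ℕ} (h : j ≠ i) (b : Ev W R.X i) : (ofDeg W R i b) j = 0 := by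
  rw [ofDeg, DirectSum.lof_eq_of]
  exact DirectSum.of_eq_of_ne _ _ _ h

/-- `g_*(ofDeg p a) = ofDeg q (pushDeg p q a)` for `q = p + dim Y − dim X` -/
theorem push_ofDeg_eq {p : ℕ} (a : Ev W P.X p) (hp : P.n ≤ p + Q.n) :
    push W g (ofDeg W P p a) = ofDeg W Q (p + Q.n - P.n) (pushDeg W g p (p + Q.n - P.n) a) := by
  classical
  refine DFinsupp.ext fun q' => ?_
  by_cases hq : q' = p + Q.n - P.n
  · subst hq
    simp only [pushDeg_apply, ofDeg, DirectSum.lof_eq_of, DirectSum.of_eq_same]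
  · rw [ofDeg_apply_of_ne W Q hq]
    by_cases hq' : Q.n < q'
    · exact ev_eq_zero_of_lt W Q hq' _
    · exact push_ofDeg_apply_eq_zero W g a (not_lt.1 hq') (by omega)

/-- `g_*` kills the classes of degree below `dim X − dim Y` -/
theorem push_ofDeg_eq_zero {p : ℕ} (a : Ev W P.X p) (hp : p + Q.n < P.n) :
    push W g (ofDeg W P p a) = 0 := by
  refine DFinsupp.ext fun q' => ?_
  show _ = (0 : Ev W Q.X q')
  by_cases hq' : Q.n < q'
  · exact ev_eq_zero_of_lt W Q hq' _
  · exact push_ofDeg_apply_eq_zero W g a (not_lt.1 hq') (by omega)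

/-- THE ALGEBRAICITY OF THE PUSH-FORWARD, degree by degree: the transposed graph class `β^* u` of `g`
induces `g_*` (the host's `IsInducedBy`), so `map_ratAlgebraicClasses_of_isInducedBy` applies. -/
theorem pushDeg_mem (hPQ : IsSmoothProjective (P.n + Q.n) (P.X ⊗ Q.X))
    (hQP : IsSmoothProjective (Q.n + P.n) (Q.X ⊗ P.X)) {p : ℕ} (hp : p ≤ P.n) (hp' : P.n ≤ p + Q.n)
    {a : Ev W P.X p} (ha : a ∈ W.ratAlgebraicClasses P.X p) :
    pushDeg W g p (p + Q.n - P.n) a ∈ W.ratAlgebraicClasses Q.X (p + Q.n - P.n) := by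
  obtain ⟨u, hu, hind⟩ := W.exists_isInducedBy_pullback P.smooth Q.smooth g
  have hu' : W.pullback (β_ P.X Q.X).hom (2 * Q.n) u ∈ W.ratAlgebraicClasses (P.X ⊗ Q.X) Q.n :=
    W.pullback_ratAlgebraicClasses_le hPQ hQP (β_ P.X Q.X).hom Q.n ⟨u, hu, rfl⟩
  refine W.map_ratAlgebraicClasses_of_isInducedBy P.smooth Q.smooth (c := Q.n) (p := p)
    (q := p + Q.n - P.n) (j' := 2 * (Q.n - (p + Q.n - P.n)))
    (W.pullback (β_ P.X Q.X).hom (2 * Q.n) u) (pushDeg W g p (p + Q.n - P.n)) (by omega) (by omega)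
    hu' ?_ a ha
  intro x y
  -- the left side: `⟨g_* (ofDeg p x), ofDeg y⟩_Y = ⟨ofDeg p x, g^* (ofDeg y)⟩_X`
  rw [pushDeg_apply,
    ← pairing_ofDeg_right W Q (push W g (ofDeg W P p x))
      (by omega : (p + Q.n - P.n) + (Q.n - (p + Q.n - P.n)) = Q.n) y,
    pairing_push_ofDeg_ofDeg, dif_pos (by omega)]
  -- the right side, rotated in the even ring of `X × Y`
  rw [trace_eq_integral W _ _ hPQ, ofDeg_cup_cup W ⟨_, _, hPQ⟩ (by omega)]
  have hrot : ofDeg W ⟨_, _, hPQ⟩ p (W.pullback (fst P.X Q.X) (2 * p) x) *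
        ofDeg W ⟨_, _, hPQ⟩ Q.n (W.pullback (β_ P.X Q.X).hom (2 * Q.n) u) *
        ofDeg W ⟨_, _, hPQ⟩ (Q.n - (p + Q.n - P.n)) (W.pullback (snd P.X Q.X) _ y) =
      ofDeg W ⟨_, _, hPQ⟩ (Q.n - (p + Q.n - P.n)) (W.pullback (snd P.X Q.X) _ y) *
        ofDeg W ⟨_, _, hPQ⟩ Q.n (W.pullback (β_ P.X Q.X).hom (2 * Q.n) u) *
        ofDeg W ⟨_, _, hPQ⟩ p (W.pullback (fst P.X Q.X) (2 * p) x) := by ring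
  rw [hrot, ← ofDeg_cup_cup W ⟨_, _, hPQ⟩ (by omega : Q.n - (p + Q.n - P.n) + Q.n + p = P.n + Q.n)
    (by omega), ← trace_eq_integral W _ _ hPQ]
  -- the rotated product is the pull-back of the graph correspondence along the braiding
  have hw : castDeg W (by omega : 2 * (Q.n + P.n) = 2 * (P.n + Q.n))
      (W.pullback (β_ P.X Q.X).hom (2 * (Q.n + P.n))
        (W.cup (by omega : 2 * (Q.n - (p + Q.n - P.n)) + 2 * Q.n + 2 * p = 2 * (Q.n + P.n))
          (W.cup rfl (W.pullback (fst Q.X P.X) _ y) u) (W.pullback (snd Q.X P.X) (2 * p) x))) =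
      W.cup (by omega) (W.cup rfl (W.pullback (snd P.X Q.X) _ y) (W.pullback (β_ P.X Q.X).hom (2 * Q.n) u))
        (W.pullback (fst P.X Q.X) (2 * p) x) := by
    rw [W.map_cup hPQ hQP, W.map_cup hPQ hQP, pullback_pullback, pullback_pullback, braiding_hom_fst,
      braiding_hom_snd, castDeg_cup]
  rw [← hw, trace_castDeg W (by omega : Q.n + P.n = P.n + Q.n), trace_pullback_braiding W P Q hPQ hQP _ rfl]
  -- the graph correspondence induces `g^*`
  have hi := hind (2 * (Q.n - (p + Q.n - P.n))) (2 * p) (by omega) y x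
  rw [← hi, cup_comm_even' W P.smooth]

/-- THE PUSH-FORWARD OF AN ALGEBRAIC CLASS IS ALGEBRAIC (Fulton p. 371 / Lemma A4.1.2 in the Weil vocabulary,
from the host's correspondence axiom). -/
theorem push_mem_algSub (hPQ : IsSmoothProjective (P.n + Q.n) (P.X ⊗ Q.X))
    (hQP : IsSmoothProjective (Q.n + P.n) (Q.X ⊗ P.X)) (hP : HasGen P) (hQ : HasGen Q)
    {x : EvenRing W P} (hx : x ∈ algSub W P hP) : push W g x ∈ algSub W Q hQ := by
  rw [mem_algSub_iff] at hx ⊢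
  refine Submodule.span_induction ?_ ?_ ?_ ?_ hx
  · intro z hz
    obtain ⟨p, a, ha, rfl⟩ := Set.mem_iUnion.1 hz
    by_cases hp : P.n < p
    · rw [ev_eq_zero_of_lt W P hp a, map_zero, map_zero]
      exact Submodule.zero_mem _
    · by_cases hp' : P.n ≤ p + Q.n
      · rw [push_ofDeg_eq W g a hp']
        exact Submodule.subset_span
          (ofDeg_mem_algSet W Q (pushDeg_mem W g hPQ hQP (not_lt.1 hp) hp' ha))
      · rw [push_ofDeg_eq_zero W g a (not_le.1 hp')]
        exact Submodule.zero_mem _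
  · simp
  · intro y z _ _ hy hz
    rw [map_add]; exact Submodule.add_mem _ hy hz
  · intro r y _ hy
    rw [map_smul]; exact Submodule.smul_mem _ r hy

end pushAlg

section final

variable {ι : Type u} (S : ι → SPVar k) (hgen : ∀ a, HasGen (S a))

/-- `PushAlg` holds as soon as the pairwise products are smooth projective (the host's named fact
`IsSmoothProjective.tensor`). -/
theorem pushAlg_of_tensor
    (htensor : ∀ a b, IsSmoothProjective ((S a).n + (S b).n) ((S a).X ⊗ (S b).X)) : PushAlg W S hgen :=
  fun {a b} g _ hx => push_mem_algSub W g (htensor a b) (htensor b a) (hgen a) (hgen b) hx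

variable (htensor : ∀ a b, IsSmoothProjective ((S a).n + (S b).n) ((S a).X ⊗ (S b).X))

/-- A2's `CycleTheory` ON THE HOST WEIL COHOMOLOGY, with no input beyond `W`, the generic points and the
smoothness of the products. -/
def cycleTheoryOfWeil : CycleTheory.{u} := cycleTheory W S hgen (pushAlg_of_tensor W S hgen htensor)

/-- THE SEVEN DISPLAYED FACTS OF T6A2Gysin, ALL THEOREMS ON THE HOST WEIL COHOMOLOGY. -/
theorem cycleTheoryOfWeil_hypotheses :
    (cycleTheoryOfWeil W S hgen htensor).Functoriality ∧
      (cycleTheoryOfWeil W S hgen htensor).BredonCupProduct ∧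
      (cycleTheoryOfWeil W S hgen htensor).BredonCapProduct ∧
      (cycleTheoryOfWeil W S hgen htensor).AugmentationNatural ∧
      (cycleTheoryOfWeil W S hgen htensor).PoincareDuality ∧
      (cycleTheoryOfWeil W S hgen htensor).FultonProperPushForward ∧
      (cycleTheoryOfWeil W S hgen htensor).FultonCycleClassRingHom :=
  cycleTheory_hypotheses W S hgen _

end final

end Summit.Ventures.HodgeRepro2.T6.WeilInst

end
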